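import Literature.MathematicalPhysics.QuantumLattice.HubbardTorusMarkovClusterPressureTorusLimit
import HarnessLib

/-!
# Rectangular Markov windows: the certified upper edge of the thermal energy window from a C1 certificate
# on an `a × b` rectangle with its corner representative (all window bookkeeping discharged)

Topic `MathematicalPhysics/QuantumLattice`, namespace `Literature.MathematicalPhysics.QuantumLattice`.

The weighted-cluster Markov certificate theorems (`HubbardTorusMarkovPressureClusterBound.lean`,
`HubbardTorusMarkovClusterPressureTorusLimit.lean`) take an abstract window `Λ ⊆ [0, ℓ)²` with its
lexicographically largest site `a`, the corner condition `a − eᵢ ∈ Λ` and `Λ`-valued annihilator data. For the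
RECTANGLES actually used by the `hubbard-thermal` free-energy programme (certificate C1 on `3 × 2`, `4 × 2`, …;
rows = coordinate `0`, columns = coordinate `1`, so that the Jordan–Wigner order `Pi.Lex` of the tree IS the
producer's raster order "row-major, corner last") this file discharges that bookkeeping once:

* §1 `rectWindow a b` (`HubbardAndersonClusterBound.lean`: `x 0 ∈ [0,a)`, `x 1 ∈ [0,b)`) — membership
  (`mem_rectWindow_iff`), the corner `mkSite2 (a−1) (b−1)` is a member and lexicographically largest
  (`toLex_le_toLex_rectCorner`, via `Pi.toLex_monotone`), its inner neighbours `corner − eᵢ` are members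
  (`a, b ≥ 2`), and `rectWindow a b ⊆ [0, max a b)²`;
* §2 the headline `IsTorusLimitOfMixture.meanEnergy_hubbardTTPrime_le_of_rectMarkovCertificate`: for every
  torus limit `ω` of the canonical sector Gibbs states of the square-lattice Hubbard model (`t' = 0`, `U ≥ 0`,
  `0 ≤ n < 2`) at `β`, every `0 < β_h < β`, every C1 certificate on `rectWindow a b` (`a, b ≥ 2`) at
  `(β_h, μ)` — corner representative `h_μ = cornerEnergyRep`, structured annihilator `G`, shield = rectangle
  minus corner, dual `L_B`, constant `c` — and every `T = 0` row `e(t,0,U,n) ≤ e⁺`: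
  `e_Φ(ω) ≤ (c − β_h μ n + β e⁺)/(β − β_h)`. The matrix certificate and the `T = 0` row are the only
  hypotheses; this is the shape consumed by the venture's certificate rows.

[cite: PoulinHastings2011, eqs. (3)–(8)] (Markov bound with a dual certificate);
[cite: GustafsonSigal2003, §18.3 Theorem 18.10] (zero-entropy cold anchor). Everything is PROVED; no definition,
no named fact.
-/

noncomputable section

namespace Literature.MathematicalPhysics.QuantumLattice

open Matrix Finset HubbardWave0 Literature.Probability.LatticeModels ThermodynamicLimit AndersonCluster
open _root_.Filter
open scoped _root_.Topology ComplexOrder MatrixOrder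

/-! ### §1. Rectangles: membership, the corner, the lexicographic maximum -/

section Rect

/-- Membership in the rectangle `[0,a) × [0,b)` (public form of the private `mem_rectWindow` of
`HubbardAndersonClusterBound.lean`). [cite: Anderson1951, eq. (2)] -/
theorem mem_rectWindow_iff {a b : ℕ} {x : Site 2} :
    x ∈ rectWindow a b ↔ (0 ≤ x 0 ∧ x 0 < a) ∧ (0 ≤ x 1 ∧ x 1 < b) := by
  rw [rectWindow, Finset.mem_filter, mem_halfOpenBox, Fin.forall_fin_two]
  push_cast
  constructor
  · rintro ⟨⟨h0, h1⟩, ha, hb⟩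
    exact ⟨⟨h0.1, ha⟩, ⟨h1.1, hb⟩⟩
  · rintro ⟨⟨h0, ha⟩, ⟨h1, hb⟩⟩
    exact ⟨⟨⟨h0, by omega⟩, ⟨h1, by omega⟩⟩, ha, hb⟩

/-- The rectangle sits in the box `[0, max a b)²`. [cite: FriedliVelenik2017, §3.1] -/
theorem rectWindow_subset_halfOpenBox_max (a b : ℕ) : rectWindow a b ⊆ halfOpenBox 2 (max a b) := fun x hx => by
  have h := mem_rectWindow_iff.1 hx
  refine mem_halfOpenBox.2 (Fin.forall_fin_two.2 ⟨⟨h.1.1, ?_⟩, ⟨h.2.1, ?_⟩⟩)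
  · have : (a : ℤ) ≤ ((max a b : ℕ) : ℤ) := by exact_mod_cast le_max_left a b
    exact lt_of_lt_of_le h.1.2 this
  · have : (b : ℤ) ≤ ((max a b : ℕ) : ℤ) := by exact_mod_cast le_max_right a b
    exact lt_of_lt_of_le h.2.2 this

/-- `mkSite2 c r 0 = c`. [cite: Anderson1951, eq. (2)] -/
@[simp] theorem mkSite2_apply_zero (c r : ℕ) : mkSite2 c r 0 = c := rfl

/-- `mkSite2 c r 1 = r`. [cite: Anderson1951, eq. (2)] -/
@[simp] theorem mkSite2_apply_one (c r : ℕ) : mkSite2 c r 1 = r := rfl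

/-- A site with coordinates `c < a`, `r < b` lies in the rectangle. [cite: Anderson1951, eq. (2)] -/
theorem mkSite2_mem_rectWindow {a b c r : ℕ} (hc : c < a) (hr : r < b) : mkSite2 c r ∈ rectWindow a b := by
  refine mem_rectWindow_iff.2 ⟨⟨?_, ?_⟩, ⟨?_, ?_⟩⟩
  · show (0 : ℤ) ≤ (c : ℤ); omega
  · show (c : ℤ) < a; omega
  · show (0 : ℤ) ≤ (r : ℤ); omega
  · show (r : ℤ) < b; omega

/-- **The corner** `(a−1, b−1)` lies in the rectangle (`a, b ≥ 1`). [cite: Anderson1951, eq. (2)] -/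
theorem rectCorner_mem_rectWindow {a b : ℕ} (ha : 1 ≤ a) (hb : 1 ≤ b) :
    mkSite2 (a - 1) (b - 1) ∈ rectWindow a b :=
  mkSite2_mem_rectWindow (by omega) (by omega)

/-- **The corner is the lexicographically largest site of the rectangle** (it dominates every site
coordinatewise, and `toLex` is monotone). [cite: ArakiMoriya2003, §4.1 Def. 4.3] -/
theorem toLex_le_toLex_rectCorner {a b : ℕ} :
    ∀ y ∈ rectWindow a b, toLex y ≤ toLex (mkSite2 (a - 1) (b - 1)) := by
  intro y hy
  have h := mem_rectWindow_iff.1 hy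
  have h0 := h.1.2
  have h1 := h.2.2
  refine Pi.toLex_monotone (Fin.forall_fin_two.2 ⟨?_, ?_⟩)
  · show y 0 ≤ ((a - 1 : ℕ) : ℤ)
    omega
  · show y 1 ≤ ((b - 1 : ℕ) : ℤ)
    omega

/-- The corner minus `e₀` is `(a−2, b−1)`. [cite: Anderson1951, eq. (2)] -/
theorem rectCorner_sub_unitVec_zero (a b : ℕ) (ha : 2 ≤ a) :
    mkSite2 (a - 1) (b - 1) - unitVec (0 : Fin 2) = mkSite2 (a - 2) (b - 1) := by
  funext j
  fin_cases j
  · show ((a - 1 : ℕ) : ℤ) - (Pi.single (0 : Fin 2) (1 : ℤ) : Site 2) 0 = ((a - 2 : ℕ) : ℤ)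
    simp
    omega
  · show ((b - 1 : ℕ) : ℤ) - (Pi.single (0 : Fin 2) (1 : ℤ) : Site 2) 1 = ((b - 1 : ℕ) : ℤ)
    simp

/-- The corner minus `e₁` is `(a−1, b−2)`. [cite: Anderson1951, eq. (2)] -/
theorem rectCorner_sub_unitVec_one (a b : ℕ) (hb : 2 ≤ b) :
    mkSite2 (a - 1) (b - 1) - unitVec (1 : Fin 2) = mkSite2 (a - 1) (b - 2) := by
  funext j
  fin_cases j
  · show ((a - 1 : ℕ) : ℤ) - (Pi.single (1 : Fin 2) (1 : ℤ) : Site 2) 0 = ((a - 1 : ℕ) : ℤ)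
    simp
  · show ((b - 1 : ℕ) : ℤ) - (Pi.single (1 : Fin 2) (1 : ℤ) : Site 2) 1 = ((b - 2 : ℕ) : ℤ)
    simp
    omega

/-- **The inner neighbours of the corner** `(a−1, b−1) − eᵢ` lie in the rectangle when `a, b ≥ 2` (the
corner representative's bonds). [cite: Anderson1951, eq. (2)] -/
theorem rectCorner_sub_unitVec_mem_rectWindow {a b : ℕ} (ha : 2 ≤ a) (hb : 2 ≤ b) (i : Fin 2) :
    mkSite2 (a - 1) (b - 1) - unitVec i ∈ rectWindow a b := by
  revert i
  refine Fin.forall_fin_two.2 ⟨?_, ?_⟩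
  · rw [rectCorner_sub_unitVec_zero a b ha]
    exact mkSite2_mem_rectWindow (by omega) (by omega)
  · rw [rectCorner_sub_unitVec_one a b hb]
    exact mkSite2_mem_rectWindow (by omega) (by omega)

end Rect

/-! ### §2. The certified upper edge from a rectangular C1 certificate -/

section Torus

namespace InfVolFermionState

variable {t U n β : ℝ} {ω : InfVolFermionState 2} {Ls : ℕ → ℕ}

/-- **Certified upper edge of the thermal energy window from a C1 certificate on an `a × b` rectangle.**
Let `ω` be a torus limit of the canonical sector Gibbs states of the square-lattice Hubbard model (`t' = 0`,
`U ≥ 0`, `0 ≤ n < 2`) at `β` along `Ls → ∞`, `0 < β_h < β`, `μ` real, `a, b ≥ 2`. A C1 certificate on the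
rectangle `Λ = rectWindow a b` (rows `x 0 ∈ [0,a)`, columns `x 1 ∈ [0,b)`, corner `A = (a−1, b−1)`, shield
`Λ ∖ A`) at `(β_h, μ)` consists of: finitely many annihilator terms `g_i (O_i − τ_{z_i} O_i)` (Hermitian local
`O_i ∈ 𝔄_{S_i}`, `S_i, S_i + z_i ⊆ Λ`), a Hermitian dual `L_B ∈ 𝔄_{Λ∖A}` and a constant `c` such that
`e^c · exp(L_B) − tr_A exp(−β_h (h_μ + G) + Γ L_B) ⪰ 0`, where
`h_μ = U n_{A↑}n_{A↓} − μ n_A − t (hop(A − e₀, A) + hop(A − e₁, A))` (`cornerEnergyRep`). Then, with any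
`T = 0` row `e(t,0,U,n) ≤ e⁺`: `e_Φ(ω) ≤ (c − β_h μ n + β e⁺)/(β − β_h)`.
[cite: PoulinHastings2011, eqs. (3)–(8)] [cite: GustafsonSigal2003, §18.3 Theorem 18.10] -/
theorem IsTorusLimitOfMixture.meanEnergy_hubbardTTPrime_le_of_rectMarkovCertificate
    (hU : 0 ≤ U) (hn0 : 0 ≤ n) (hn2 : n < 2)
    (h : ω.IsTorusLimitOfMixture (sectorGibbsCount n) (fun L => sectorGibbsWeightTT' β t 0 U n L)
      (fun L => sectorGibbsVectorTT' t 0 U n L) Ls)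
    (hLs : Tendsto Ls atTop atTop) {βh : ℝ} (hβh : 0 < βh) (hlt : βh < β) (μ : ℝ)
    {a b : ℕ} (ha : 2 ≤ a) (hb : 2 ≤ b)
    {ι : Type*} (s : Finset ι) (S : ι → Finset (Site 2)) (hS : ∀ i, S i ⊆ rectWindow a b) (z : ι → Site 2)
    (hz : ∀ i, shiftSet (z i) (S i) ⊆ rectWindow a b) {O : ∀ i, FermionOp (S i)}
    (hO : ∀ i ∈ s, (O i).IsHermitian) (g : ι → ℝ)
    {LB : FermionOp ((rectWindow a b).erase (mkSite2 (a - 1) (b - 1)))} (hLB : LB.IsHermitian) {c : ℝ}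
    (hcert : ((Real.exp c : ℂ) • cfc Real.exp LB -
      fermionPartialTrace (PolySite.incl (Finset.erase_subset (mkSite2 (a - 1) (b - 1)) (rectWindow a b)))
        (cfc Real.exp (-((βh : ℂ) • (cornerEnergyRep (rectWindow a b) (mkSite2 (a - 1) (b - 1)) t U μ +
            windowAnnihilator s (rectWindow a b) S hS z hz O g)) +
          fermionEmbed (PolySite.incl (Finset.erase_subset (mkSite2 (a - 1) (b - 1)) (rectWindow a b))) LB))).PosSemidef)
    {eup : ℝ} (he : energyDensityTT' t 0 U n ≤ eup) :
    ω.meanEnergy (hubbardTTPrimeFermionInteraction t 0 U) 1 ≤ (c - βh * μ * n + β * eup) / (β - βh) :=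
  h.meanEnergy_hubbardTTPrime_le_of_cornerMarkovCertificate hU hn0 hn2 hLs hβh hlt μ
    (rectCorner_mem_rectWindow (by omega) (by omega)) toLex_le_toLex_rectCorner
    (rectCorner_sub_unitVec_mem_rectWindow ha hb) (rectWindow_subset_halfOpenBox_max a b)
    s S hS z hz hO g hLB hcert he

end InfVolFermionState

end Torus

end Literature.MathematicalPhysics.QuantumLattice

end
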